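/-
Origin: expansion seat `planner-pub-hodgecm-pv01-0`, handover 2026-08-18T03:38:05Z (`HOME/pub-hodgecm-pv01/lean/Pv01/ArchBookkeeping.lean`, md5 ced1de57, 169 lines);
landed by the gen-5 packager in gate run 19 as `HodgeCM/PerL34/ArchBookkeeping.lean` (import ^import Pv01\.→import HodgeCM.PerL34. ×1).
-/
/-
Origin: HOME/pub-hodgecm-pv01/lean/Pv01/ArchBookkeeping.lean (module `Pv01.ArchBookkeeping`; the packager renames to
`HodgeCM.PerL34.ArchBookkeeping`) — session planner-pub-hodgecm-pv01-0 (unit pub-hodgecm-pv01, DAG-NODE PROVER #01).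
DAG node (HOME/LEMMAS.md v2 §1): N26 (PerL v5 §4.1 `ss:arch`, opening paragraph, tex ll. 472–478), typed BY THE
PROVER SEAT verbatim from the tex block over an ABSTRACT local Fock shell (LEMMAS.md §3 D5: the package has no
Fock-model / `(𝔤,K)`-module vocabulary).  What is KERNEL-PROVED and what is a LABELLED INPUT is said on every item.
Also: the algebraic core of Lemma 4.1(a) (tex l. 493) over the same shell, for the N27 seat.
-/
import Summits.HodgeConjecture.HodgeCM.PerL34.CircleCharacters

set_option autoImplicit false

/-!
# PerL v5 §4.1 — archimedean bookkeeping: the vacuum exponents `e_b(Ψ_i)` (DAG node N26)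

Tex ll. 472–478 (VERBATIM, `inputs/2001/…paper-v5-d912a121.tex`):

  "Fix a real place `b`. For a line `W_i` with its forced sign and splitting character
  `\mu_{i,b}(z)=(z/|z|)^{m_b}` (the exponent `m_b=m_b(\Psi_i)` resp. `m_{\rm hol}` determines `\mu_{i,b}`,
  \cite[\S3]{Y1neg}), let `\mathcal F_{i,b}` be the Fock model of `\omega_{W_i,b}` and
  `\phi^0_{i,b}\in\mathcal F_{i,b}` a generator of the isotypic component of `\mathbf 1_{\U(3)}` (`b\ne\iota_1`; it is
  the vacuum line, \cite[Lemma~3.2]{Y1neg}) resp. the harmonic `z_{1}` generating `J^+` (`b=\iota_1`,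
  \cite[Lemma~3.1]{Y1neg}); `\U(W_{i,b})=\U(1)` acts on it by a character `u\mapsto u^{-e_b(\Psi_i)}`, which
  \emph{defines} `e_b(\Psi_i)\in\Z`. Since the local data `(W_{i,b},\mu_{i,b},\chi_V,\psi)` depend on `i` only through
  the sign of `W_{i,b}`, i.e. through `m_b(\Psi_i)` (Lemma~\ref{lem:allowed}(a)), so does `e_b(\Psi_i)` for
  `b\ne\iota_1`, and `e_{\iota_1}(\Psi_i)` is independent of `i`."

## Dictionary (abstract local Fock shell)

* `\mathcal F_{i,b}` ↦ a complex normed space `V`; the restriction of `ω_{W_i,b}` to `\U(W_{i,b}) = \U(1)` ↦ a monoid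
  homomorphism `ρ : Circle →* (V →L[ℂ] V)` (only the `\U(1)`-action is needed for this node);
* `\phi^0_{i,b}` ↦ a non-zero vector `φ⁰ : V` whose line is `\U(1)`-stable (`∀ u, ρ u φ⁰ ∈ ℂ φ⁰`) with
  `u ↦ ρ u φ⁰` continuous.  LABELLED INPUT (PRINT): the EXISTENCE of such a `φ⁰` — "the isotypic component of
  `\mathbf 1_{\U(3)}` is a line (the vacuum line)" for `b ≠ ι₁`, "the harmonic `z_1` generates `J^+`" for
  `b = ι₁` — is [Y1neg] Lemmas 3.1/3.2 = the `K`-type structure of Fock models of compact/type-I dual pairs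
  (Kashiwara–Vergne 1978; Adams), NOT proved here: it is the hypothesis `(φ⁰, hφ, hline, hcont)` of every
  statement below;
* "`\U(1)` acts on it by a character `u\mapsto u^{-e_b(\Psi_i)}`, which defines `e_b(\Psi_i)\in\Z`" ↦
  `vacuumExponent` + `vacuumExponent_spec` + `vacuumExponent_unique` — KERNEL-PROVED (`Pv01.CircleCharacters`:
  every continuous character of `\U(1)` is `u ↦ u^n`, `n ∈ ℤ` unique);
* "the local data depend on `i` only through `m_b(\Psi_i)` … so does `e_b(\Psi_i)`" ↦ `vacuumExponent_eq_of_equivariant`: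
  the exponent is an invariant of the datum `(V, ρ, φ⁰)` under equivariant continuous linear maps sending `φ⁰₁`
  to `φ⁰₂` — KERNEL-PROVED; that equal `m_b` gives isomorphic local data is Lemma 3.3(a) (node N12) + the
  construction of `ω_{W_i,b}` — a LABELLED INPUT of the node (hypothesis `T` below), outside this file.

Nothing is asserted: no axiom, no `Prop`-valued constant posited.
-/

noncomputable section

open Complex

namespace HodgeCM
namespace PerL34
namespace ArchBookkeeping

open CircleChar

variable {V : Type*} [NormedAddCommGroup V] [NormedSpace ℂ V]

/-- **`e_b(Ψ_i)`** (PerL v5 l. 476): the unique integer `e` with `ρ u φ⁰ = u^{-e} φ⁰` for all `u ∈ \U(1)`. -/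
def vacuumExponent (ρ : Circle →* (V →L[ℂ] V)) (φ : V) (hφ : φ ≠ 0)
    (hline : ∀ u : Circle, ∃ a : ℂ, ρ u φ = a • φ) (hcont : Continuous fun u : Circle => ρ u φ) : ℤ :=
  (existsUnique_lineExponent ρ φ hφ hline hcont).choose

/-- (Ported verbatim from the HodgeCMPerL package; no docstring in the source.) -/
theorem vacuumExponent_spec (ρ : Circle →* (V →L[ℂ] V)) (φ : V) (hφ : φ ≠ 0)
    (hline : ∀ u : Circle, ∃ a : ℂ, ρ u φ = a • φ) (hcont : Continuous fun u : Circle => ρ u φ) (u : Circle) :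
    ρ u φ = ((u : ℂ) ^ (-(vacuumExponent ρ φ hφ hline hcont))) • φ :=
  (existsUnique_lineExponent ρ φ hφ hline hcont).choose_spec.1 u

/-- (Ported verbatim from the HodgeCMPerL package; no docstring in the source.) -/
theorem vacuumExponent_unique (ρ : Circle →* (V →L[ℂ] V)) (φ : V) (hφ : φ ≠ 0)
    (hline : ∀ u : Circle, ∃ a : ℂ, ρ u φ = a • φ) (hcont : Continuous fun u : Circle => ρ u φ)
    {e : ℤ} (he : ∀ u : Circle, ρ u φ = ((u : ℂ) ^ (-e)) • φ) :
    e = vacuumExponent ρ φ hφ hline hcont :=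
  (existsUnique_lineExponent ρ φ hφ hline hcont).choose_spec.2 e he

section Invariance

variable {V' : Type*} [NormedAddCommGroup V'] [NormedSpace ℂ V']

/-- **"so does `e_b(\Psi_i)`"** (l. 477–478), the kernel part: the vacuum exponent is an invariant of the local
datum — if a continuous linear map `T` intertwines the two `\U(1)`-actions and sends `φ⁰₁` to `φ⁰₂`, the exponents
agree.  (That equal `m_b(Ψ_1) = m_b(Ψ_2)` produces such a `T` — indeed equal local data — is Lemma 3.3(a) /
node N12 and the construction of the local Weil representation: a labelled input, not used here.) -/
theorem vacuumExponent_eq_of_equivariant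
    (ρ₁ : Circle →* (V →L[ℂ] V)) (φ₁ : V) (hφ₁ : φ₁ ≠ 0)
    (hline₁ : ∀ u : Circle, ∃ a : ℂ, ρ₁ u φ₁ = a • φ₁) (hcont₁ : Continuous fun u : Circle => ρ₁ u φ₁)
    (ρ₂ : Circle →* (V' →L[ℂ] V')) (φ₂ : V') (hφ₂ : φ₂ ≠ 0)
    (hline₂ : ∀ u : Circle, ∃ a : ℂ, ρ₂ u φ₂ = a • φ₂) (hcont₂ : Continuous fun u : Circle => ρ₂ u φ₂)
    (T : V →L[ℂ] V') (hT : T φ₁ = φ₂) (hTeq : ∀ u : Circle, ∀ v : V, T (ρ₁ u v) = ρ₂ u (T v)) :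
    vacuumExponent ρ₁ φ₁ hφ₁ hline₁ hcont₁ = vacuumExponent ρ₂ φ₂ hφ₂ hline₂ hcont₂ := by
  apply vacuumExponent_unique ρ₂ φ₂ hφ₂ hline₂ hcont₂
  intro u
  rw [← hT, ← hTeq, vacuumExponent_spec ρ₁ φ₁ hφ₁ hline₁ hcont₁ u, map_smul]

end Invariance

/-! ### The node statement N26 -/

/-- **N26 (PerL v5 §4.1, tex ll. 472–478)**, over the abstract local Fock shell (see the module docstring for the
dictionary and for which clauses are labelled inputs):
(i) "`\U(1)` acts on [the line `ℂφ⁰`] by a character `u\mapsto u^{-e}`, which defines `e\in\Z`": for every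
continuous `\U(1)`-action `ρ` on a complex normed space stabilising the line through `φ⁰ ≠ 0` there is a UNIQUE
integer `e` with `ρ u φ⁰ = u^{-e} φ⁰`;
(ii) "so does `e_b(\Psi_i)`" / "independent of `i`": equivariantly isomorphic data (a continuous linear intertwiner
sending `φ⁰₁` to `φ⁰₂`) have the same exponent. -/
def N26_statement : Prop :=
  (∀ (V : Type) [NormedAddCommGroup V] [NormedSpace ℂ V] (ρ : Circle →* (V →L[ℂ] V)) (φ : V), φ ≠ 0 →
      (∀ u : Circle, ∃ a : ℂ, ρ u φ = a • φ) → (Continuous fun u : Circle => ρ u φ) →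
      ∃! e : ℤ, ∀ u : Circle, ρ u φ = ((u : ℂ) ^ (-e)) • φ) ∧
  (∀ (V : Type) [NormedAddCommGroup V] [NormedSpace ℂ V] (V' : Type) [NormedAddCommGroup V'] [NormedSpace ℂ V']
      (ρ₁ : Circle →* (V →L[ℂ] V)) (φ₁ : V) (ρ₂ : Circle →* (V' →L[ℂ] V')) (φ₂ : V') (e₁ e₂ : ℤ),
      φ₂ ≠ 0 → (∀ u : Circle, ρ₁ u φ₁ = ((u : ℂ) ^ (-e₁)) • φ₁) → (∀ u : Circle, ρ₂ u φ₂ = ((u : ℂ) ^ (-e₂)) • φ₂) →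
      ∀ T : V →L[ℂ] V', T φ₁ = φ₂ → (∀ u : Circle, ∀ v : V, T (ρ₁ u v) = ρ₂ u (T v)) → e₁ = e₂)

/-- **N26 holds** (kernel-checked; axioms `propext`, `Classical.choice`, `Quot.sound`). -/
theorem N26_holds : N26_statement := by
  refine ⟨fun V _ _ ρ φ hφ hline hcont => existsUnique_lineExponent ρ φ hφ hline hcont, ?_⟩
  intro V _ _ V' _ _ ρ₁ φ₁ ρ₂ φ₂ e₁ e₂ hφ₂ h₁ h₂ T hT hTeq
  -- transport `h₁` along `T` and compare with `h₂` on the non-zero vector `φ₂`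
  have key : ∀ u : Circle, ((u : ℂ) ^ (-e₁)) • φ₂ = ((u : ℂ) ^ (-e₂)) • φ₂ := by
    intro u
    rw [← h₂ u, ← hT, ← hTeq, h₁ u, map_smul]
  have hpow : ∀ u : Circle, (u : ℂ) ^ (-e₁) = (u : ℂ) ^ (-e₂) := fun u => smul_left_injective ℂ hφ₂ (key u)
  have : -e₁ = -e₂ := zpow_injective' fun z => Circle.ext (by simpa using hpow z)
  omega

/-! ### The algebraic core of Lemma 4.1(a) (tex l. 493), for node N27

"(a) `\theta(\omega(u)\phi,\chi')=\chi'(u)^{-1}\theta(\phi,\chi')` for `u\in\U(W_i)(\A)`, and `\theta(\phi,\chi'_i)\in\pi_i`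
has archimedean component `J^+\otimes\mathbf 1^{\otimes}`, so only the `\phi_b` in the corresponding isotypic parts
contribute, on which `\U(W_{i,b})` acts by `u^{-e_b(\Psi_i)}`" — hence `\chi'_{i,b}(u)=u^{e_b(\Psi_i)}`. -/

section L41a

variable {S : Type*} [AddCommGroup S] [Module ℂ S]

/-- **Core of PerL v5 Lemma 4.1(a), direction (⇒)** over the abstract shell: a linear "theta functional" `θ` on
the local Fock space with the equivariance `θ (ρ u v) = (c u)⁻¹ • θ v` (l. 493; `c = χ'_{i,b}`), which factors
through a projection `P` commuting with the `\U(1)`-action ("only the `\phi_b` in the corresponding isotypic parts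
contribute" — LABELLED INPUT: archimedean component `J^+ ⊗ 1`) on whose range `\U(1)` acts by `u^{-e}` (LABELLED
INPUT: [KV78]/[Y1neg] L3.1–3.2 + the definition of `e`), and which is non-zero, forces `c u = u^{e}`. -/
theorem char_eq_zpow_of_equivariant (ρ : Circle →* (V →L[ℂ] V)) (θ : V →ₗ[ℂ] S) (c : Circle →* ℂ)
    (hequiv : ∀ (u : Circle) (v : V), θ (ρ u v) = (c u)⁻¹ • θ v)
    (P : V →L[ℂ] V) (hPθ : ∀ v : V, θ (P v) = θ v) (hcomm : ∀ (u : Circle) (v : V), P (ρ u v) = ρ u (P v))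
    (e : ℤ) (hP : ∀ (u : Circle) (v : V), ρ u (P v) = ((u : ℂ) ^ (-e)) • P v)
    (hne : ∃ v : V, θ v ≠ 0) : ∀ u : Circle, c u = (u : ℂ) ^ e := by
  obtain ⟨v, hv⟩ := hne
  intro u
  have h1 : θ (ρ u v) = ((u : ℂ) ^ (-e)) • θ v := by
    rw [← hPθ (ρ u v), hcomm, hP, map_smul, hPθ]
  rw [hequiv] at h1
  have h2 : (c u)⁻¹ = (u : ℂ) ^ (-e) := smul_left_injective ℂ hv h1
  rw [zpow_neg] at h2
  exact inv_injective h2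

end L41a

end ArchBookkeeping

/-- Re-export under the node name expected by LEMMAS.md §4 (`def Nxx_<name> : Prop`). -/
def N26_vacuumExponents : Prop := ArchBookkeeping.N26_statement

/-- (Ported verbatim from the HodgeCMPerL package; no docstring in the source.) -/
theorem N26_vacuumExponents_holds : N26_vacuumExponents := ArchBookkeeping.N26_holds

end PerL34
end HodgeCM

end
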